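import Mathlib.Probability.Independence.InfinitePi
import Mathlib.Probability.BorelCantelli
import Mathlib.MeasureTheory.Constructions.UnitInterval
import Mathlib.Analysis.PSeries
import HarnessLib

/-!
# Batty–Bollmann 1980, Example 2.3: in an INFINITE product the almost-everywhere lattice hypothesis
# does NOT give the four functions inequality (the Hilbert cube `[0,1]^ℕ`)

CITATION HEADER.  Source: C. J. K. Batty, H. W. Bollmann, *Generalised Holley–Preston inequalities on
measure spaces and their products*, Z. Wahrscheinlichkeitstheorie verw. Gebiete **53** (1980) 157–173
[BattyBollmann1980], read 2026-08-21 from the publisher PDF.  Verbatim (p. 163): "**Example 2.3.** Let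
`𝒮` be the direct product of a sequence of measurably paired probability spaces `𝒮_n`, and suppose that
there exist `𝒯_n`-measurable sets `E_n` such that `Σ_n μ_n(E_n) = ∞`, `Σ_n μ_n²(φ_n⁻¹(E_n)) < ∞`.  Let
`E = {x ∈ X : x_n ∈ E_n for infinitely many n}`.  By the Borel–Cantelli lemmas, `μ(E) = 1` and
`μ²(φ⁻¹(E)) = 0`.  Thus the function `(1, 1, 1 − χ_E, 1)` is `μ`-compatible.  However if each `𝒮_n` and
hence `𝒮` is diagonally invariant, this function is not diagonally `μ`-compatible, so `𝒮` is not
diagonally settled.  As a specific example, we can take `𝒮_n` to be the unit interval `[0, 1]` equipped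
with Lebesgue measure and the lattice operations, and `E_n = [0, n⁻¹]`."  And (p. 167): "Strong
𝔐-expansiveness is rarely preserved under infinite direct products. For instance the `μ`-compatible
function `(1, 1, 1 − χ_E, 1)` as constructed in Example 2.3 does not satisfy (3.2)
[`μ(f₁) μ(f₂) ≤ μ(f₃) μ(f₄)`]."  (Contrast: for FINITE products the a.e. hypothesis suffices — Prop. 3.4
and Thm. 3.7 of the paper, tree `Literature.Probability.LatticeModels.lintegral_four_functions_ae`; and
for infinite products of chains the EVERYWHERE hypothesis suffices — Cor. 3.9.)

## What is formalised (theorems only; no definition, no named fact, no sorry)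

On the Hilbert cube `ℕ → I` (`I = [0,1]`, Mathlib `unitInterval` with its Lebesgue probability measure)
with `P = ⊗_ℕ λ` (`Measure.infinitePi`) and the coordinatewise lattice operations, with
`E_n = {x : x_n ≤ (n+1)⁻¹}` (the printed `[0, n⁻¹]`, index shifted by one) and `E = limsup E_n`:
* `BattyBollmann.infinitePi_limsup_eq_one` — `P(E) = 1` (second Borel–Cantelli lemma, the coordinates
  being independent under `P`, `Σ (n+1)⁻¹ = ∞`);
* `BattyBollmann.prod_sup_mem_limsup_eq_zero` — `(P ⊗ P){(x, y) : x ∨ y ∈ E} = 0` (first Borel–Cantelli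
  lemma, `Σ (n+1)⁻² < ∞`);
* `BattyBollmann.example_2_3` — hence the four functions `(1, 1, 1 − χ_E, 1)` satisfy the lattice
  hypothesis `f₁(x) f₂(y) ≤ f₃(x ∨ y) f₄(x ∧ y)` for `P ⊗ P`-ALMOST EVERY pair, the diagonal inequality
  `f₁(x) f₂(x) ≤ f₃(x) f₄(x)` FAILS for `P`-almost every `x`, and
  `(∫ f₁)(∫ f₂) = 1 > 0 = (∫ f₃)(∫ f₄)`: the almost-everywhere four functions theorem is false for this
  infinite product.
-/

noncomputable section

open MeasureTheory ProbabilityTheory Filter Set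
open scoped ENNReal Topology unitInterval

namespace Literature.Probability.LatticeModels.BattyBollmann

/-- The threshold `(n+1)⁻¹` as a point of the unit interval. [folklore] -/
private theorem inv_succ_mem (n : ℕ) : ((n : ℝ) + 1)⁻¹ ∈ I :=
  ⟨by positivity, inv_le_one_of_one_le₀ (by exact_mod_cast Nat.le_add_left 1 n)⟩

/-- The coordinate events `E_n = {x : x_n ≤ (n+1)⁻¹}` of Example 2.3. [cite: BattyBollmann1980, Example 2.3] -/
private theorem measurableSet_event (n : ℕ) :
    MeasurableSet {x : ℕ → I | x n ≤ ⟨((n : ℝ) + 1)⁻¹, inv_succ_mem n⟩} :=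
  (measurable_pi_apply n) measurableSet_Iic

/-- `P(E_n) = (n+1)⁻¹`. [cite: BattyBollmann1980, Example 2.3] -/
private theorem infinitePi_event (n : ℕ) :
    Measure.infinitePi (fun _ : ℕ => (volume : Measure I))
        {x : ℕ → I | x n ≤ ⟨((n : ℝ) + 1)⁻¹, inv_succ_mem n⟩} = ENNReal.ofReal (((n : ℝ) + 1)⁻¹) := by
  have h := (measurePreserving_eval_infinitePi (fun _ : ℕ => (volume : Measure I)) n).measure_preimage
    (measurableSet_Iic (a := (⟨((n : ℝ) + 1)⁻¹, inv_succ_mem n⟩ : I))).nullMeasurableSet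
  rw [unitInterval.volume_Iic] at h
  exact h

/-- The harmonic-type series `Σ (n+1)⁻¹` diverges in `[0,∞]`. [folklore] -/
private theorem tsum_ofReal_inv_succ : ∑' n : ℕ, ENNReal.ofReal (((n : ℝ) + 1)⁻¹) = ∞ := by
  by_contra h
  have hs : Summable fun n : ℕ => (((n : ℝ) + 1)⁻¹).toNNReal :=
    ENNReal.tsum_coe_ne_top_iff_summable.1 h
  have hs' : Summable fun n : ℕ => ((n : ℝ) + 1)⁻¹ := by
    have := NNReal.summable_coe.2 hs
    refine this.congr fun n => ?_
    exact Real.coe_toNNReal _ (by positivity)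
  have : Summable fun n : ℕ => ((n : ℕ) : ℝ)⁻¹ := by
    rw [← summable_nat_add_iff 1]
    refine hs'.congr fun n => ?_
    push_cast
    ring
  exact Real.not_summable_natCast_inv this

/-- `Σ (n+1)⁻² < ∞` in `[0,∞]`. [folklore] -/
private theorem tsum_ofReal_inv_succ_sq_ne_top :
    ∑' n : ℕ, ENNReal.ofReal (((n : ℝ) + 1)⁻¹) * ENNReal.ofReal (((n : ℝ) + 1)⁻¹) ≠ ∞ := by
  have e : ∀ n : ℕ, ENNReal.ofReal (((n : ℝ) + 1)⁻¹) * ENNReal.ofReal (((n : ℝ) + 1)⁻¹) =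
      ENNReal.ofReal ((((n : ℝ) + 1) ^ 2)⁻¹) := by
    intro n
    rw [← ENNReal.ofReal_mul (by positivity), pow_two, mul_inv]
  simp_rw [e]
  refine ENNReal.tsum_coe_ne_top_iff_summable.2 ?_
  have hs : Summable fun n : ℕ => (((n : ℝ) + 1) ^ 2)⁻¹ := by
    have h2 : Summable fun n : ℕ => (((n : ℕ) : ℝ) ^ 2)⁻¹ := Real.summable_nat_pow_inv.2 one_lt_two
    rw [← summable_nat_add_iff 1] at h2
    refine h2.congr fun n => ?_
    push_cast
    ring
  exact hs.toNNReal

/-- **`P(E) = 1`** for `E = limsup E_n` on the Hilbert cube: the coordinate events are independent under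
the product measure and `Σ P(E_n) = Σ (n+1)⁻¹ = ∞` (second Borel–Cantelli lemma).
[cite: BattyBollmann1980, Example 2.3 ("By the Borel–Cantelli lemmas, μ(E) = 1")] -/
theorem infinitePi_limsup_eq_one :
    Measure.infinitePi (fun _ : ℕ => (volume : Measure I))
      (limsup (fun n => {x : ℕ → I | x n ≤ ⟨((n : ℝ) + 1)⁻¹, inv_succ_mem n⟩}) atTop) = 1 := by
  set P := Measure.infinitePi (fun _ : ℕ => (volume : Measure I)) with hP
  -- independence of the coordinate events
  have hind : iIndepFun (fun (n : ℕ) (x : ℕ → I) => x n) P :=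
    iIndepFun_infinitePi (P := fun _ : ℕ => (volume : Measure I)) (X := fun _ t => t)
      fun _ => measurable_id
  have hset : iIndepSet (fun n => {x : ℕ → I | x n ≤ ⟨((n : ℝ) + 1)⁻¹, inv_succ_mem n⟩}) P := by
    rw [iIndepSet_iff_meas_biInter fun n => measurableSet_event n]
    intro S
    exact hind.measure_inter_preimage_eq_mul S
      (sets := fun n => Iic (⟨((n : ℝ) + 1)⁻¹, inv_succ_mem n⟩ : I)) fun n _ => measurableSet_Iic
  refine measure_limsup_eq_one (fun n => measurableSet_event n) hset ?_
  simp_rw [hP, infinitePi_event]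
  exact tsum_ofReal_inv_succ

/-- **`(P ⊗ P){(x, y) : x ∨ y ∈ E} = 0`**: `x ∨ y ∈ E_n` iff both `x_n, y_n ≤ (n+1)⁻¹`, an event of
`P ⊗ P`-probability `(n+1)⁻²`, summable (first Borel–Cantelli lemma).
[cite: BattyBollmann1980, Example 2.3 ("μ²(φ⁻¹(E)) = 0")] -/
theorem prod_sup_mem_limsup_eq_zero :
    (Measure.infinitePi (fun _ : ℕ => (volume : Measure I))).prod
        (Measure.infinitePi (fun _ : ℕ => (volume : Measure I)))
      {p | p.1 ⊔ p.2 ∈ limsup (fun n => {x : ℕ → I | x n ≤ ⟨((n : ℝ) + 1)⁻¹, inv_succ_mem n⟩}) atTop}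
        = 0 := by
  set P := Measure.infinitePi (fun _ : ℕ => (volume : Measure I)) with hP
  set A : ℕ → Set (ℕ → I) := fun n => {x : ℕ → I | x n ≤ ⟨((n : ℝ) + 1)⁻¹, inv_succ_mem n⟩} with hA
  -- the preimage of `limsup A` under `(x, y) ↦ x ∨ y` is `limsup (A n ×ˢ A n)`
  have hpre : {p : (ℕ → I) × (ℕ → I) | p.1 ⊔ p.2 ∈ limsup A atTop} =
      limsup (fun n => A n ×ˢ A n) atTop := by
    ext p
    simp only [limsup_eq_iInf_iSup_of_nat, mem_setOf_eq, iInf_eq_iInter, iSup_eq_iUnion, mem_iInter,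
      mem_iUnion, hA, mem_prod, Pi.sup_apply, sup_le_iff, exists_prop]
  rw [hpre]
  refine measure_limsup_atTop_eq_zero ?_
  have e : ∀ n, (P.prod P) (A n ×ˢ A n) =
      ENNReal.ofReal (((n : ℝ) + 1)⁻¹) * ENNReal.ofReal (((n : ℝ) + 1)⁻¹) := by
    intro n
    rw [Measure.prod_prod, hP, hA]
    simp only
    rw [infinitePi_event]
  simp_rw [e]
  exact tsum_ofReal_inv_succ_sq_ne_top

/-- **Batty–Bollmann 1980, Example 2.3 (the Hilbert cube `[0,1]^ℕ` with product Lebesgue measure and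
the coordinatewise lattice operations)**: with `E = limsup {x_n ≤ (n+1)⁻¹}` and the four functions
`(f₁, f₂, f₃, f₄) = (1, 1, 1 − χ_E, 1)`:
(a) the lattice hypothesis `f₁(x) f₂(y) ≤ f₃(x ∨ y) f₄(x ∧ y)` holds for `P ⊗ P`-ALMOST EVERY pair
("`μ`-compatible"); (b) the diagonal inequality `f₁(x) f₂(x) ≤ f₃(x) f₄(x)` fails for `P`-almost every
`x` (so the function is "not diagonally `μ`-compatible": the infinite product is not diagonally settled);
(c) `(∫ f₁)(∫ f₂) = 1` while `(∫ f₃)(∫ f₄) = 0` — the conclusion (3.2) of the four functions theorem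
FAILS: the almost-everywhere hypothesis, sufficient in every finite product (Prop. 3.4, Thm. 3.7), is not
sufficient in an infinite one.  [cite: BattyBollmann1980, Example 2.3 and p. 167] -/
theorem example_2_3 :
    ∃ E : Set (ℕ → I), MeasurableSet E ∧
      (∀ᵐ p ∂(Measure.infinitePi (fun _ : ℕ => (volume : Measure I))).prod
          (Measure.infinitePi (fun _ : ℕ => (volume : Measure I))),
        (1 : ℝ≥0∞) * 1 ≤ Eᶜ.indicator 1 (p.1 ⊔ p.2) * 1) ∧
      (∀ᵐ x ∂Measure.infinitePi (fun _ : ℕ => (volume : Measure I)),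
        ¬ ((1 : ℝ≥0∞) * 1 ≤ Eᶜ.indicator 1 x * 1)) ∧
      (∫⁻ _x, (1 : ℝ≥0∞) ∂Measure.infinitePi (fun _ : ℕ => (volume : Measure I))) *
          (∫⁻ _x, (1 : ℝ≥0∞) ∂Measure.infinitePi (fun _ : ℕ => (volume : Measure I))) = 1 ∧
      (∫⁻ x, Eᶜ.indicator (1 : (ℕ → I) → ℝ≥0∞) x ∂Measure.infinitePi (fun _ : ℕ => (volume : Measure I))) *
          (∫⁻ _x, (1 : ℝ≥0∞) ∂Measure.infinitePi (fun _ : ℕ => (volume : Measure I))) = 0 := by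
  set P := Measure.infinitePi (fun _ : ℕ => (volume : Measure I)) with hP
  set E := limsup (fun n => {x : ℕ → I | x n ≤ ⟨((n : ℝ) + 1)⁻¹, inv_succ_mem n⟩}) atTop with hE
  have hEm : MeasurableSet E := MeasurableSet.measurableSet_limsup fun n => measurableSet_event n
  have hE1 : P E = 1 := infinitePi_limsup_eq_one
  have hEc : P Eᶜ = 0 := by
    rw [measure_compl hEm (measure_ne_top P E), hE1, measure_univ, tsub_self]
  refine ⟨E, hEm, ?_, ?_, ?_, ?_⟩
  · -- (a) a.e.-pair compatibility: off the null set `{x ∨ y ∈ E}`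
    have h0 := prod_sup_mem_limsup_eq_zero
    rw [measure_eq_zero_iff_ae_notMem] at h0
    filter_upwards [h0] with p hp
    rw [indicator_of_mem (mem_compl hp)]
    simp
  · -- (b) the diagonal inequality fails on `E`, i.e. almost everywhere
    rw [measure_eq_zero_iff_ae_notMem] at hEc
    filter_upwards [hEc] with x hx
    rw [indicator_of_notMem hx]
    simp
  · -- (c) left-hand side
    rw [lintegral_const, measure_univ, mul_one, mul_one]
  · -- (c) right-hand side
    rw [lintegral_indicator hEm.compl]
    simp [hEc]

end Literature.Probability.LatticeModels.BattyBollmann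

end
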